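import Literature.Computability.FineGrained.Conjectures
import Literature.Computability.Cryptography.GraphPathProblemsBounds
import HarnessLib

/-!
# Subcubic equivalence of APSP and Negative Triangle (VW–W 2018, Thm. 1.1): the decomposition

`Literature.Computability.FineGrained.Conjectures` records Vassilevska Williams–Williams, J. ACM 65
(2018), Thm. 1.1, (1) ⟺ (3), as the named fact
`subcubicEquivalent_APSP_negativeTriangle : SubcubicEquivalentFamily APSP NegativeTriangle`, an
existence statement about concrete word-RAM oracle programs (`FGReducible`, VVW ICM 2018, Def. 2.1 /
VW–W Def. 3.1). This file decomposes it along the printed proof (loc. cit., p. 27:22: "The subcubic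
equivalence of problems (1), (3), (4), (5), and (6) directly follow from Theorems 4.1, 4.2, and 4.3",
together with the classical equivalence of APSP and the distance product, §2 p. 27:8) into named
facts, proves the glue, and proves the well-formedness side conditions of the zoo problems that the
glue and the consequences in `Conjectures` consume.

* **The two halves** (named facts): `APSP_fgReducible_negativeTriangle` (APSP `≤₃` Negative
  Triangle, up to a polynomial change of the weight exponent) and `negativeTriangle_fgReducible_APSP`;
  the target is literally their conjunction (`subcubicEquivalent_APSP_negativeTriangle_iff`, proved).
* **The route through the distance product** (named facts, the paper's own steps):
  `negativeTriangle_fgReducible_minPlusProduct` (Thm. 4.1), `minPlusProduct_fgReducible_APSP`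
  (proof of Thm. 5.1: the tripartite graph), `APSP_fgReducible_minPlusProduct` (§2 p. 27:8, after
  Fischer–Meyer [28]), `minPlusProduct_fgReducible_negativeTriangle` (Thm. 4.2), and the transitivity
  of `≤₃` (`fgReducible_pow_trans_of_sizeFitsWord`, VW–W Prop. 1, transcribed with the word-RAM
  hypotheses of the prelude's `FGReducible.trans` plus `SizeFitsWord`, see below); the halves follow
  (`negativeTriangle_fgReducible_APSP_of_minPlusProduct`,
  `APSP_fgReducible_negativeTriangle_of_minPlusProduct`, proved), and so does the companion fact
  `subcubicEquivalent_APSP_minPlusProduct` of `Conjectures`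
  (`subcubicEquivalent_APSP_minPlusProduct_of_reductions`, proved).
* **Well-formedness, proved**: `APSP_isStandard`, `NegativeTriangle_isStandard`,
  `MinPlusProduct_isStandard` — the zoo problems are `FGProblem.IsStandard` for the budget `n ^ 3`
  (encoding length `n² + O(1) = (n³)^{2/3} + O(1)`, input width `O(c log n) ≤ (c + 2)(n + 1)`, and
  word-representable outputs: shortest distances lie in `[-n·nᶜ, n·nᶜ]` and distance products in
  `[-2nᶜ, 2nᶜ]`, `Literature.Computability.Cryptography.GraphPathProblemsBounds`). These were the
  hypotheses left open in `trulySubTime_APSP_iff_negativeTriangle_of_isStandard`; with them the printed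
  consequence "either both are truly subcubic or neither is" follows from the two remaining named
  facts alone (`trulySubTime_APSP_iff_negativeTriangle_of_facts`, proved).

What remains open (named facts, to be discharged bottom-up by verified word-RAM programs): the four
reductions and the transitivity/inline-simulation principle. The direction Negative Triangle `≤₃`
APSP needs a single oracle query (a layered graph) and is the natural first target; the direction
APSP `≤₃` Negative Triangle is VW–W Thm. 4.2 (simultaneous binary search over `n²` blocked instances
of size `n^{1/3}`, Lemmas 4.1–4.2) preceded by `⌈log₂ n⌉` distance products.

## On the transitivity fact

VW–W Prop. 1 ("A ≤_q B and B ≤_q C imply A ≤_q C", p. 27:10, proof p. 27:11: "replace each oracle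
call on an instance `xᵢ` … with a call to `P_{B,ε'}` on `xᵢ`") is transcribed for a common budget
`n ^ q` with the hypotheses under which the printed inline simulation is available in the word-RAM
model: the prelude's `IsStandard` conventions (as in `FGReducible.trans`) and, exactly as in the
corrected transfer property `FGReducible.trulySubTime_of_sizeFitsWord`
(`Literature.Computability.Cryptography.FGComplexity`, *Size measures that fit in a word*), the
hypothesis `A.SizeFitsWord` (in print the size is the input length, so it is automatic): with it the
budget `n^q`, all query/answer lengths, and the word sizes `k_B · inputWidth y` of the inline runs are
`< 2^{O(w)}` and each simulated step costs `O(1)`; without it none of this is guaranteed. The zoo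
problems satisfy all these hypotheses (`APSP_sizeFitsWord`, … in `Conjectures`; `…_isStandard` here),
so the assembled halves are unconditional in them.

## References

* V. Vassilevska Williams, R. R. Williams, *Subcubic equivalences between path, matrix, and triangle
  problems*, J. ACM 65 (2018), Art. 27: Thm. 1.1 (p. 27:3, restated p. 27:22), §2 p. 27:8, Def. 3.1
  and Prop. 1 (p. 27:10–11), §4 p. 27:13, Thm. 4.1 (p. 27:14), Thm. 4.2 (p. 27:14, proof p. 27:17),
  proof of Thm. 5.1 (p. 27:22). doi:10.1145/3186893
* V. Vassilevska Williams, *On some fine-grained questions in algorithms and complexity*, Proc. ICM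
  2018, §2 (word RAM, Def. 2.1).
* M. J. Fischer, A. R. Meyer, *Boolean matrix multiplication and transitive closure*, SWAT/FOCS 1971
  (VW–W ref. [28]).
-/

namespace Literature.Computability.FineGrained

open Cryptography Cryptography.WordRAM

/-! ### The two halves of VW–W Thm. 1.1, (1) ⟺ (3) -/

/-- **VW–W 2018, Thm. 1.1, direction (1) `≤₃` (3)**: for every weight exponent `c` there is `c'`
and a subcubic fine-grained reduction (both budgets `n ^ 3`) from APSP on `n`-node digraphs with
weights in `[-nᶜ, nᶜ]` (no negative cycles) to Negative Triangle on graphs with weights in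
`[-n^{c'}, n^{c'}]`. In print: APSP `≤₃` distance product (§2, p. 27:8) `≤₃` Negative Triangle
(Thm. 4.2); the weight range grows polynomially (§4, p. 27:13), whence `∃ c'`.
[cite: VassilevskaWilliamsWilliams2018, Thm. 1.1 (p. 27:3; proof p. 27:22 via Thm. 4.2)] -/
def APSP_fgReducible_negativeTriangle : Prop :=
  ∀ c : ℕ, ∃ c' : ℕ,
    FGReducible (APSP c) (fun n => (n : ℝ) ^ (3 : ℝ)) (NegativeTriangle c') (fun n => (n : ℝ) ^ (3 : ℝ))

/-- **VW–W 2018, Thm. 1.1, direction (3) `≤₃` (1)**: for every weight exponent `c` there is `c'` and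
a subcubic fine-grained reduction from Negative Triangle with weights in `[-nᶜ, nᶜ]` to APSP with
weights in `[-n^{c'}, n^{c'}]`. In print: Negative Triangle `≤₃` matrix product verification
(Thm. 4.1) `≤₃` distance product (trivially) `≤₃` APSP (the tripartite graph of the proof of
Thm. 5.1, p. 27:22). [cite: VassilevskaWilliamsWilliams2018, Thm. 1.1 (p. 27:3; proof p. 27:22 via Thm. 4.1)] -/
def negativeTriangle_fgReducible_APSP : Prop :=
  ∀ c : ℕ, ∃ c' : ℕ,
    FGReducible (NegativeTriangle c) (fun n => (n : ℝ) ^ (3 : ℝ)) (APSP c') (fun n => (n : ℝ) ^ (3 : ℝ))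

/-- The target fact of `Conjectures` is literally the conjunction of the two halves. [folklore] -/
theorem subcubicEquivalent_APSP_negativeTriangle_iff :
    subcubicEquivalent_APSP_negativeTriangle ↔
      APSP_fgReducible_negativeTriangle ∧ negativeTriangle_fgReducible_APSP :=
  Iff.rfl

/-- **Glue for VW–W Thm. 1.1, (1) ⟺ (3)**: the two halves assemble to
`subcubicEquivalent_APSP_negativeTriangle`. [cite: VassilevskaWilliamsWilliams2018, Thm. 1.1] -/
theorem subcubicEquivalent_APSP_negativeTriangle_of_reductions (h₁ : APSP_fgReducible_negativeTriangle)
    (h₂ : negativeTriangle_fgReducible_APSP) : subcubicEquivalent_APSP_negativeTriangle :=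
  ⟨h₁, h₂⟩

/-! ### The route through the distance product (VW–W §4 and §5) -/

/-- **VW–W 2018, Thm. 4.1** (Negative Triangle over `R̄` `≤₃` matrix product verification over `R̄`,
p. 27:14, in `O(T(2n))`), composed with the trivial reduction of verification to computing the
product, in the `(min,+)` structure on `ℤ` (where tripartiteness is unnecessary, §2 p. 27:7): for every
`c` there is `c'` and a subcubic fine-grained reduction from Negative Triangle with weights in
`[-nᶜ, nᶜ]` to the `(min,+)`-product with entries in `[-n^{c'}, n^{c'}]`. The combinatorial core
("`i, k, j` is a negative triangle iff `A[i,k] ⊙ B[k,j] < C[i,j]` for some `k`") is the proved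
`hasNegativeTriangle_iff_minPlus_holds`: one product of the weight matrix (diagonal set to `⊤`) with
itself, then `n²` comparisons. [cite: VassilevskaWilliamsWilliams2018, Thm. 4.1 (p. 27:14)] -/
def negativeTriangle_fgReducible_minPlusProduct : Prop :=
  ∀ c : ℕ, ∃ c' : ℕ,
    FGReducible (NegativeTriangle c) (fun n => (n : ℝ) ^ (3 : ℝ)) (MinPlusProduct c')
      (fun n => (n : ℝ) ^ (3 : ℝ))

/-- **Distance product `≤₃` APSP** (VW–W 2018, proof of Thm. 5.1, p. 27:22: "Consider the
edge-weighted … tripartite graph `G` with `n`-node partitions `I, J, K` … `w(i, j) = A[i, j]` …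
`w(j, k) = B[j, k]` … the shortest path between `i` and `k` using exactly two edges, thus computing the
`(min,+)` product of `A` and `B`"; for directed APSP the layered graph is acyclic and no weight shift
is needed): for every `c` there is `c'` and a subcubic fine-grained reduction from the
`(min,+)`-product with entries in `[-nᶜ, nᶜ]` to APSP with weights in `[-n^{c'}, n^{c'}]` (one query
on `3n` vertices). [cite: VassilevskaWilliamsWilliams2018, proof of Thm. 5.1 (p. 27:22)] -/
def minPlusProduct_fgReducible_APSP : Prop :=
  ∀ c : ℕ, ∃ c' : ℕ,
    FGReducible (MinPlusProduct c) (fun n => (n : ℝ) ^ (3 : ℝ)) (APSP c') (fun n => (n : ℝ) ^ (3 : ℝ))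

/-- **APSP `≤₃` distance product** (VW–W 2018, §2 p. 27:8: "Matrix multiplication over the
`(min,+)`-semiring … can be used to solve all-pairs shortest paths (APSP) in arbitrary weighted graphs
[28]. That is, truly subcubic distance product would imply truly subcubic APSP", after Fischer–Meyer
1971; classically by `⌈log₂ n⌉` squarings of `1 ⊕ W`, cf. `walkDistLE`, each on entries in
`[-n·nᶜ, n·nᶜ]` by `hasBoundedWeights_walkDistLE`): for every `c` there is `c'` and a subcubic
fine-grained reduction from APSP with weights in `[-nᶜ, nᶜ]` to the `(min,+)`-product with entries in
`[-n^{c'}, n^{c'}]`. [cite: VassilevskaWilliamsWilliams2018, §2 p. 27:8 (citing Fischer–Meyer [28])] -/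
def APSP_fgReducible_minPlusProduct : Prop :=
  ∀ c : ℕ, ∃ c' : ℕ,
    FGReducible (APSP c) (fun n => (n : ℝ) ^ (3 : ℝ)) (MinPlusProduct c') (fun n => (n : ℝ) ^ (3 : ℝ))

/-- **VW–W 2018, Thm. 4.2** (Matrix product over `R` `≤₃` Negative Triangle over `R`, p. 27:14, proof
p. 27:17: "the product of two `n × n` matrices over `R` can be performed in `O(n² · T(n^{1/3}) log W)`
time", via Lemma 4.1 (finding from detecting) and Lemma 4.2 (listing `IJ`-disjoint negative
triangles) and a simultaneous binary search on the entries), in the `(min,+)` structure on `ℤ`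
(`⊤` entries replaced by suitably large finite weights, footnote 12, p. 27:22): for every `c` there is
`c'` and a subcubic fine-grained reduction from the `(min,+)`-product with entries in `[-nᶜ, nᶜ]` to
Negative Triangle with weights in `[-n^{c'}, n^{c'}]`.
[cite: VassilevskaWilliamsWilliams2018, Thm. 4.2 (p. 27:14, proof p. 27:17)] -/
def minPlusProduct_fgReducible_negativeTriangle : Prop :=
  ∀ c : ℕ, ∃ c' : ℕ,
    FGReducible (MinPlusProduct c) (fun n => (n : ℝ) ^ (3 : ℝ)) (NegativeTriangle c')
      (fun n => (n : ℝ) ^ (3 : ℝ))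

/-- **Transitivity of sub-`q` reductions** (VW–W 2018, §3, Prop. 1, p. 27:10: "Let `A, B, C` be
problems so that `A ≤_q B` and `B ≤_q C`. Then `A ≤_q C`"; proof p. 27:11: given `ε'` take `δ'` for
`B ≤_q C`, run the `A ≤_q B` reduction at `ε := δ'` and "replace each oracle call on an instance `xᵢ`
… with a call to `P_{B,ε'}` on `xᵢ`"; the ledgers compose to `d_A d_B · n^{q-δ}`), transcribed for
the word-RAM rendering `FGReducible` with common budget `n ^ q`, under the hypotheses that make the
printed inline simulation available in the model: the well-formedness conventions
`FGProblem.IsStandard` of the prelude's `FGReducible.trans` (VVW ICM 2018, §2), and — exactly as for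
the corrected transfer property `FGReducible.trulySubTime_of_sizeFitsWord` — `A.SizeFitsWord` (the
size measure of `A` fits in `O(1)` machine words; automatic in print, where sizes are input lengths),
which bounds the budget, all query and answer lengths and the word sizes of the inline runs by
`2^{O(w)}`. Not yet formalised (it needs the inline-simulation compiler on `WordRAM`); every zoo
problem satisfies the hypotheses. [cite: VassilevskaWilliamsWilliams2018, §3 Prop. 1 (p. 27:10, proof p. 27:11)] -/
def fgReducible_pow_trans_of_sizeFitsWord : Prop :=
  ∀ {A B D : FGProblem} {q : ℝ},
    FGReducible A (fun n => (n : ℝ) ^ q) B (fun n => (n : ℝ) ^ q) →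
    FGReducible B (fun n => (n : ℝ) ^ q) D (fun n => (n : ℝ) ^ q) →
    (A.IsStandard fun n => (n : ℝ) ^ q) → (B.IsStandard fun n => (n : ℝ) ^ q) →
    (D.IsStandard fun n => (n : ℝ) ^ q) → A.SizeFitsWord →
    FGReducible A (fun n => (n : ℝ) ^ q) D (fun n => (n : ℝ) ^ q)

/-- The prelude's (uncorrected, hypothesis-poorer) `FGReducible.trans` implies the transcription used
here. [folklore] -/
theorem fgReducible_pow_trans_of_sizeFitsWord_of_trans (h : FGReducible.trans) :
    fgReducible_pow_trans_of_sizeFitsWord :=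
  fun hAB hBD hA hB hD _ => h hAB hBD hA hB hD

/-! ### Encodings of the zoo problems: length, entries and input width

Elementary estimates on `encodeMatrixWithTop` (VW–W's input format: `n`, then the `n²` entries with
`⊤ ↦ 0`, `z ↦ encodeInt z + 1`) feeding the `IsStandard` proofs below. -/

/-- The zig-zag code of `z` is at most `2|z|`. [folklore] -/
theorem encodeInt_le_two_mul_natAbs (z : ℤ) : encodeInt z ≤ 2 * z.natAbs := by
  cases z with
  | ofNat n => simp
  | negSucc n => simp [Int.natAbs_negSucc]

/-- The code of a finite weight `z` is at most `2|z| + 1`. [folklore] -/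
theorem encodeWithTopInt_coe_le (z : ℤ) : encodeWithTopInt (z : WithTop ℤ) ≤ 2 * z.natAbs + 1 := by
  show encodeInt z + 1 ≤ _
  have := encodeInt_le_two_mul_natAbs z
  omega

/-- The code of an `M`-bounded weight is at most `2M + 1`. [folklore] -/
theorem encodeWithTopInt_le_of_isBddWeight {a : WithTop ℤ} {M : ℕ} (h : IsBddWeight M a) :
    encodeWithTopInt a ≤ 2 * M + 1 := by
  rcases h with rfl | ⟨z, rfl, hz⟩
  · exact Nat.zero_le _
  · refine le_trans (encodeWithTopInt_coe_le z) ?_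
    have : z.natAbs ≤ M := by
      have : (z.natAbs : ℤ) ≤ M := by rwa [Int.natCast_natAbs]
      exact_mod_cast this
    omega

/-- The words of an encoded weight matrix are `n` and the codes of its entries. [folklore] -/
theorem mem_encodeMatrixWithTop {n : ℕ} (W : Matrix (Fin n) (Fin n) (WithTop ℤ)) {v : ℕ}
    (hv : v ∈ encodeMatrixWithTop W) : v = n ∨ ∃ i j, v = encodeWithTopInt (W i j) := by
  simp only [encodeMatrixWithTop, List.mem_cons, List.mem_flatMap, List.mem_finRange, List.mem_map,
    true_and] at hv
  rcases hv with rfl | ⟨i, j, rfl⟩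
  · exact Or.inl rfl
  · exact Or.inr ⟨i, j, rfl⟩

/-- Every word of the encoding of a matrix with `M`-bounded weights is at most `max n (2M + 1)`.
[folklore] -/
theorem forall_mem_encodeMatrixWithTop_le {n : ℕ} {W : Matrix (Fin n) (Fin n) (WithTop ℤ)} {M : ℕ}
    (hW : HasBoundedWeights W M) : ∀ v ∈ encodeMatrixWithTop W, v ≤ max n (2 * M + 1) := by
  intro v hv
  rcases mem_encodeMatrixWithTop W hv with rfl | ⟨i, j, rfl⟩
  · exact le_max_left _ _
  · exact le_trans (encodeWithTopInt_le_of_isBddWeight (hW i j)) (le_max_right _ _)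

/-- `x.foldr max 1 < B` as soon as `1 < B` and every entry is `< B`. [folklore] -/
theorem foldr_max_lt {x : List ℕ} {B : ℕ} (h1 : 1 < B) (h : ∀ v ∈ x, v < B) : x.foldr max 1 < B := by
  induction x with
  | nil => simpa using h1
  | cons a l ih =>
    rw [List.foldr_cons]
    exact max_lt (h a List.mem_cons_self) (ih fun v hv => h v (List.mem_cons_of_mem _ hv))

/-- **Upper bound on the input width**: if the length and all entries of `x` are `< 2 ^ b` (`b ≥ 1`),
then `inputWidth x ≤ b`. [folklore] -/
theorem inputWidth_le_of_lt {x : List ℕ} {b : ℕ} (hb : 1 ≤ b) (hlen : x.length < 2 ^ b)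
    (hent : ∀ v ∈ x, v < 2 ^ b) : inputWidth x ≤ b := by
  unfold inputWidth
  rw [Nat.size_le]
  refine max_lt hlen (foldr_max_lt ?_ hent)
  calc (1 : ℕ) < 2 ^ 1 := by norm_num
    _ ≤ 2 ^ b := Nat.pow_le_pow_right (by norm_num) hb

/-- **Lower bound on the word capacity**: `(x.length + 1) ^ k ≤ 2 ^ (k * inputWidth x)`, so anything
below `(x.length + 1) ^ k` fits in a `k * inputWidth x`-bit word. [folklore] -/
theorem lt_two_pow_mul_inputWidth {x : List ℕ} {k v : ℕ} (h : v < (x.length + 1) ^ k) :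
    v < 2 ^ (k * inputWidth x) := by
  refine lt_of_lt_of_le h ?_
  rw [Nat.pow_mul']
  exact Nat.pow_le_pow_left (length_lt_two_pow_inputWidth x) k

/-- `n ^ c ≤ 2 ^ (c n)`. [folklore] -/
theorem pow_le_two_pow_mul (n c : ℕ) : n ^ c ≤ 2 ^ (c * n) := by
  rw [Nat.pow_mul']
  exact Nat.pow_le_pow_left (Nat.lt_two_pow_self).le c

/-- `2 (n² + 1) < 2 ^ (2 (n + 1))` (the length of one or two encoded `n × n` matrices fits).
[folklore] -/
theorem two_mul_sq_succ_lt_two_pow (n : ℕ) : 2 * (n ^ 2 + 1) < 2 ^ (2 * (n + 1)) := by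
  have h2 : n ^ 2 < 2 ^ (2 * n) := by
    rw [Nat.pow_mul']
    exact Nat.pow_lt_pow_left Nat.lt_two_pow_self two_ne_zero
  calc 2 * (n ^ 2 + 1) < 2 * 2 ^ (2 * n) + 2 * 2 ^ (2 * n) := by omega
    _ = 2 ^ (2 * (n + 1)) := by ring

/-- `2M + 1 < 2 ^ (c n + 2)` for `M ≤ nᶜ` (the code of an `nᶜ`-bounded weight fits). [folklore] -/
theorem two_mul_add_one_lt_two_pow {n c M : ℕ} (hM : M ≤ n ^ c) : 2 * M + 1 < 2 ^ (c * n + 2) := by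
  have hc : n ^ c ≤ 2 ^ (c * n) := pow_le_two_pow_mul n c
  have h1 : 1 ≤ 2 ^ (c * n) := Nat.one_le_two_pow
  calc 2 * M + 1 < 2 * 2 ^ (c * n) + 2 * 2 ^ (c * n) := by omega
    _ = 2 ^ (c * n + 2) := by ring

/-- **The input width of an encoded weight matrix** with weights bounded by `n ^ c` is at most
`(c + 2)(n + 1)` (i.e. `O(c log n)` bits, crudely bounded). [folklore] -/
theorem inputWidth_encodeMatrixWithTop_le {n c : ℕ} {W : Matrix (Fin n) (Fin n) (WithTop ℤ)}
    (hW : HasBoundedWeights W (n ^ c)) :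
    inputWidth (encodeMatrixWithTop W) ≤ (c + 2) * (n + 1) := by
  have hb2 : 2 * (n + 1) ≤ (c + 2) * (n + 1) := Nat.mul_le_mul_right _ (by omega)
  have hbc : c * n + 2 ≤ (c + 2) * (n + 1) := by nlinarith
  refine inputWidth_le_of_lt (by nlinarith) ?_ ?_
  · rw [encodeMatrixWithTop_length]
    exact lt_of_lt_of_le (lt_of_le_of_lt (by omega) (two_mul_sq_succ_lt_two_pow n))
      (Nat.pow_le_pow_right (by norm_num) hb2)
  · intro v hv
    refine lt_of_le_of_lt (forall_mem_encodeMatrixWithTop_le hW v hv) (max_lt ?_ ?_)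
    · exact lt_of_lt_of_le Nat.lt_two_pow_self
        (Nat.pow_le_pow_right (by norm_num) (by nlinarith))
    · exact lt_of_lt_of_le (two_mul_add_one_lt_two_pow (le_refl _))
        (Nat.pow_le_pow_right (by norm_num) hbc)

/-- The input width of two concatenated encoded weight matrices (the `(min,+)`-product input) with
weights bounded by `n ^ c` is at most `(c + 2)(n + 1)`. [folklore] -/
theorem inputWidth_append_encodeMatrixWithTop_le {n c : ℕ} {A B : Matrix (Fin n) (Fin n) (WithTop ℤ)}
    (hA : HasBoundedWeights A (n ^ c)) (hB : HasBoundedWeights B (n ^ c)) :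
    inputWidth (encodeMatrixWithTop A ++ encodeMatrixWithTop B) ≤ (c + 2) * (n + 1) := by
  have hb2 : 2 * (n + 1) ≤ (c + 2) * (n + 1) := Nat.mul_le_mul_right _ (by omega)
  have hbc : c * n + 2 ≤ (c + 2) * (n + 1) := by nlinarith
  refine inputWidth_le_of_lt (by nlinarith) ?_ ?_
  · rw [List.length_append, encodeMatrixWithTop_length, encodeMatrixWithTop_length, ← two_mul]
    exact lt_of_lt_of_le (two_mul_sq_succ_lt_two_pow n) (Nat.pow_le_pow_right (by norm_num) hb2)
  · intro v hv
    have hv' : v ≤ max n (2 * n ^ c + 1) := by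
      rcases List.mem_append.1 hv with h | h
      · exact forall_mem_encodeMatrixWithTop_le hA v h
      · exact forall_mem_encodeMatrixWithTop_le hB v h
    refine lt_of_le_of_lt hv' (max_lt ?_ ?_)
    · exact lt_of_lt_of_le Nat.lt_two_pow_self
        (Nat.pow_le_pow_right (by norm_num) (by nlinarith))
    · exact lt_of_lt_of_le (two_mul_add_one_lt_two_pow (le_refl _))
        (Nat.pow_le_pow_right (by norm_num) hbc)

/-- Output entries of the `(min,+)`-product problem fit: `max n (4 nᶜ + 1) < (2 (n² + 1) + 1)^{c+2}`.
[folklore] -/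
theorem max_lt_pow_minPlusProduct (n c : ℕ) :
    max n (2 * (n ^ c + n ^ c) + 1) < (2 * (n ^ 2 + 1) + 1) ^ (c + 2) := by
  set b : ℕ := 2 * (n ^ 2 + 1) + 1 with hb
  have hnb : n + 1 ≤ b := by rw [hb]; nlinarith
  have hX : n ^ c ≤ (n + 1) ^ c := Nat.pow_le_pow_left (Nat.le_succ n) c
  have hX1 : 1 ≤ (n + 1) ^ c := Nat.one_le_pow _ _ (Nat.succ_pos n)
  have hXb : (n + 1) ^ c ≤ b ^ c := Nat.pow_le_pow_left hnb c
  have hb2 : 9 ≤ b ^ 2 := by rw [hb]; nlinarith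
  rw [pow_add]
  refine max_lt ?_ ?_
  · calc n < b := by omega
      _ ≤ b ^ 2 := by nlinarith
      _ ≤ b ^ c * b ^ 2 := Nat.le_mul_of_pos_left _ (lt_of_lt_of_le hX1 hXb)
  · calc 2 * (n ^ c + n ^ c) + 1 < 9 * (n + 1) ^ c := by omega
      _ ≤ b ^ 2 * b ^ c := Nat.mul_le_mul hb2 hXb
      _ = b ^ c * b ^ 2 := Nat.mul_comm _ _

/-- Output entries of APSP fit: `max n (2 (n · nᶜ) + 1) < (n² + 1 + 1)^{c+3}`. [folklore] -/
theorem max_lt_pow_APSP (n c : ℕ) :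
    max n (2 * (n * n ^ c) + 1) < (n ^ 2 + 1 + 1) ^ (c + 3) := by
  set b : ℕ := n ^ 2 + 1 + 1 with hb
  have hnb : n + 1 ≤ b := by rw [hb]; nlinarith
  have hX : n * n ^ c ≤ (n + 1) ^ (c + 1) := by
    rw [pow_succ']
    exact Nat.mul_le_mul (Nat.le_succ n) (Nat.pow_le_pow_left (Nat.le_succ n) c)
  have hX1 : 1 ≤ (n + 1) ^ (c + 1) := Nat.one_le_pow _ _ (Nat.succ_pos n)
  have hXb : (n + 1) ^ (c + 1) ≤ b ^ (c + 1) := Nat.pow_le_pow_left hnb (c + 1)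
  have hb2 : 4 ≤ b ^ 2 := by rw [hb]; nlinarith
  rw [show c + 3 = (c + 1) + 2 by ring, pow_add]
  refine max_lt ?_ ?_
  · calc n < b := by omega
      _ ≤ b ^ 2 := by nlinarith
      _ ≤ b ^ (c + 1) * b ^ 2 := Nat.le_mul_of_pos_left _ (lt_of_lt_of_le hX1 hXb)
  · calc 2 * (n * n ^ c) + 1 < 4 * (n + 1) ^ (c + 1) := by omega
      _ ≤ b ^ 2 * b ^ (c + 1) := Nat.mul_le_mul hb2 hXb
      _ = b ^ (c + 1) * b ^ 2 := Nat.mul_comm _ _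

/-! ### The budget `n ^ 3` as a real function -/

/-- `(n : ℝ) ^ (3 : ℝ) = n ^ 3`. [folklore] -/
theorem rpow_three_natCast (n : ℕ) : (n : ℝ) ^ (3 : ℝ) = ((n ^ 3 : ℕ) : ℝ) := by
  rw [show (3 : ℝ) = ((3 : ℕ) : ℝ) by norm_num, Real.rpow_natCast]
  push_cast
  rfl

/-- `((n : ℝ) ^ 3) ^ (1 - 1/3) = n ^ 2`: with `δ = 1/3` the sub-budget `(n³)^{1-δ}` is `n²`, the
order of the encoding lengths. [folklore] -/
theorem rpow_three_rpow_two_thirds (n : ℕ) :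
    ((n : ℝ) ^ (3 : ℝ)) ^ (1 - 1 / 3 : ℝ) = ((n ^ 2 : ℕ) : ℝ) := by
  rw [← Real.rpow_mul (Nat.cast_nonneg n), show (3 : ℝ) * (1 - 1 / 3) = ((2 : ℕ) : ℝ) by norm_num,
    Real.rpow_natCast]
  push_cast
  rfl

/-- The budget `n ^ 3` is nonnegative. [folklore] -/
theorem rpow_three_nonneg (n : ℕ) : (0 : ℝ) ≤ (n : ℝ) ^ (3 : ℝ) :=
  Real.rpow_nonneg (Nat.cast_nonneg n) _

/-- `n ≤ n ^ 3`. [folklore] -/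
theorem natCast_le_rpow_three (n : ℕ) : (n : ℝ) ≤ (n : ℝ) ^ (3 : ℝ) := by
  rw [rpow_three_natCast]
  exact_mod_cast Nat.le_self_pow (by norm_num) n

/-- The common width estimate in budget form: `(c + 2)(n + 1) ≤ (c + 2) n³ + (c + 2)`. [folklore] -/
theorem width_bound_le_budget (c n : ℕ) :
    (((c + 2) * (n + 1) : ℕ) : ℝ) ≤ (c + 2 : ℝ) * (n : ℝ) ^ (3 : ℝ) + (c + 2) := by
  have h := natCast_le_rpow_three n
  have hc : (0 : ℝ) ≤ c + 2 := by positivity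
  push_cast
  nlinarith

/-! ### Well-formedness of the zoo problems for the budget `n ^ 3` (proved)

The "routine facts `(APSP c).IsStandard (n ^ 3)` etc., to be recorded with the zoo" announced in
`Conjectures` (docstring of `trulySubTime_APSP_iff_negativeTriangle`): the standing conventions of
VVW ICM 2018, §2 hold for VW–W's problems — inputs of `n² + O(1)` words (`= (n³)^{2/3} + O(1)`,
truly sub-budget with `δ = 1/3`), of `O(c log n) ≤ (c + 2)(n + 1)` bits each, and outputs that are
word-representable (decision bits; distance products in `[-2nᶜ, 2nᶜ]`; shortest distances in
`[-n^{c+1}, n^{c+1}]`). -/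

/-- **Negative Triangle is well formed for the budget `n ^ 3`** (`FGProblem.IsStandard`): encoding
length `n² + 1 ≤ (n³)^{2/3} + 1`, input width `≤ (c + 2)(n + 1) ≤ (c + 2) n³ + (c + 2)`, outputs `[0]`
or `[1]`. (VVW ICM 2018, §2 conventions, checked for VW–W's problem (3).) [folklore] -/
theorem NegativeTriangle_isStandard (c : ℕ) :
    (NegativeTriangle c).IsStandard fun n => (n : ℝ) ^ (3 : ℝ) where
  nonneg n := rpow_three_nonneg n
  length_le := ⟨1, 1 / 3, by norm_num, fun W => by
    change (((encodeMatrixWithTop (W.1.2.map (↑))).length : ℕ) : ℝ) ≤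
      1 * ((W.1.1 : ℝ) ^ (3 : ℝ)) ^ (1 - 1 / 3 : ℝ) + 1
    rw [encodeMatrixWithTop_length, rpow_three_rpow_two_thirds]
    push_cast
    linarith⟩
  width_le := ⟨c + 2, fun W => by
    change ((inputWidth (encodeMatrixWithTop (W.1.2.map (↑))) : ℕ) : ℝ) ≤
      (c + 2 : ℝ) * (W.1.1 : ℝ) ^ (3 : ℝ) + (c + 2)
    have hW : HasBoundedWeights (W.1.2.map (↑)) (W.1.1 ^ c) := W.2
    exact le_trans (by exact_mod_cast inputWidth_encodeMatrixWithTop_le hW)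
      (width_bound_le_budget c W.1.1)⟩
  hasWordOutputs := (FGProblem.hasWordOutputs_ofPred _ _ _).restrict _

/-- **The `(min,+)`-product is well formed for the budget `n ^ 3`**: encoding length
`2 (n² + 1) ≤ 2 (n³)^{2/3} + 2`, input width `≤ (c + 2)(n + 1)`, and the output (the encoded product,
entries in `[-2nᶜ, 2nᶜ]` by `hasBoundedWeights_minPlusProduct`) has length `n² + 1 ≤ |input| + 1` and
words `< 2 ^ ((c + 2) · width)`. [folklore] -/
theorem MinPlusProduct_isStandard (c : ℕ) :
    (MinPlusProduct c).IsStandard fun n => (n : ℝ) ^ (3 : ℝ) where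
  nonneg n := rpow_three_nonneg n
  length_le := ⟨2, 1 / 3, by norm_num, fun M => by
    change (((encodeMatrixWithTop M.1.2.1 ++ encodeMatrixWithTop M.1.2.2).length : ℕ) : ℝ) ≤
      2 * ((M.1.1 : ℝ) ^ (3 : ℝ)) ^ (1 - 1 / 3 : ℝ) + 2
    rw [List.length_append, encodeMatrixWithTop_length, encodeMatrixWithTop_length,
      rpow_three_rpow_two_thirds]
    push_cast
    linarith⟩
  width_le := ⟨c + 2, fun M => by
    change ((inputWidth (encodeMatrixWithTop M.1.2.1 ++ encodeMatrixWithTop M.1.2.2) : ℕ) : ℝ) ≤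
      (c + 2 : ℝ) * (M.1.1 : ℝ) ^ (3 : ℝ) + (c + 2)
    have hM : HasBoundedWeights M.1.2.1 (M.1.1 ^ c) ∧ HasBoundedWeights M.1.2.2 (M.1.1 ^ c) := M.2
    exact le_trans (by exact_mod_cast inputWidth_append_encodeMatrixWithTop_le hM.1 hM.2)
      (width_bound_le_budget c M.1.1)⟩
  hasWordOutputs := by
    refine ⟨c + 2, 1, fun M out hout => ?_⟩
    have hM : HasBoundedWeights M.1.2.1 (M.1.1 ^ c) ∧ HasBoundedWeights M.1.2.2 (M.1.1 ^ c) := M.2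
    have hout' : out = encodeMatrixWithTop (minPlusProduct M.1.2.1 M.1.2.2) := hout
    subst hout'
    change (encodeMatrixWithTop (minPlusProduct M.1.2.1 M.1.2.2)).length ≤
        1 * (encodeMatrixWithTop M.1.2.1 ++ encodeMatrixWithTop M.1.2.2).length + 1 ∧
      ∀ v ∈ encodeMatrixWithTop (minPlusProduct M.1.2.1 M.1.2.2),
        v < 2 ^ ((c + 2) * inputWidth (encodeMatrixWithTop M.1.2.1 ++ encodeMatrixWithTop M.1.2.2))
    refine ⟨?_, fun v hv => lt_two_pow_mul_inputWidth ?_⟩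
    · simp only [List.length_append, encodeMatrixWithTop_length]
      omega
    · rw [List.length_append, encodeMatrixWithTop_length, encodeMatrixWithTop_length, ← two_mul]
      exact lt_of_le_of_lt
        (forall_mem_encodeMatrixWithTop_le (hasBoundedWeights_minPlusProduct hM.1 hM.2) v hv)
        (max_lt_pow_minPlusProduct M.1.1 c)

/-- **APSP is well formed for the budget `n ^ 3`**: encoding length `n² + 1 ≤ (n³)^{2/3} + 1`, input
width `≤ (c + 2)(n + 1)`, and the output (the encoded distance matrix; distances in
`[-n · nᶜ, n · nᶜ]` by `hasBoundedWeights_shortestDist`, i.e. path lengths fit in `O(1)` words) has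
length `n² + 1 = |input|` and words `< 2 ^ ((c + 3) · width)`. [folklore] -/
theorem APSP_isStandard (c : ℕ) : (APSP c).IsStandard fun n => (n : ℝ) ^ (3 : ℝ) where
  nonneg n := rpow_three_nonneg n
  length_le := ⟨1, 1 / 3, by norm_num, fun W => by
    change (((encodeMatrixWithTop W.1.2).length : ℕ) : ℝ) ≤
      1 * ((W.1.1 : ℝ) ^ (3 : ℝ)) ^ (1 - 1 / 3 : ℝ) + 1
    rw [encodeMatrixWithTop_length, rpow_three_rpow_two_thirds]
    push_cast
    linarith⟩
  width_le := ⟨c + 2, fun W => by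
    change ((inputWidth (encodeMatrixWithTop W.1.2) : ℕ) : ℝ) ≤
      (c + 2 : ℝ) * (W.1.1 : ℝ) ^ (3 : ℝ) + (c + 2)
    have hW : HasBoundedWeights W.1.2 (W.1.1 ^ c) ∧ HasNoNegativeCycle W.1.2 := W.2
    exact le_trans (by exact_mod_cast inputWidth_encodeMatrixWithTop_le hW.1)
      (width_bound_le_budget c W.1.1)⟩
  hasWordOutputs := by
    refine ⟨c + 3, 1, fun W out hout => ?_⟩
    have hW : HasBoundedWeights W.1.2 (W.1.1 ^ c) ∧ HasNoNegativeCycle W.1.2 := W.2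
    have hout' : out = encodeMatrixWithTop (shortestDist W.1.2) := hout
    subst hout'
    change (encodeMatrixWithTop (shortestDist W.1.2)).length ≤
        1 * (encodeMatrixWithTop W.1.2).length + 1 ∧
      ∀ v ∈ encodeMatrixWithTop (shortestDist W.1.2),
        v < 2 ^ ((c + 3) * inputWidth (encodeMatrixWithTop W.1.2))
    refine ⟨by simp, fun v hv => lt_two_pow_mul_inputWidth ?_⟩
    rw [encodeMatrixWithTop_length]
    have hd := hasBoundedWeights_shortestDist hW.1
    rw [Fintype.card_fin] at hd
    exact lt_of_le_of_lt (forall_mem_encodeMatrixWithTop_le hd v hv) (max_lt_pow_APSP W.1.1 c)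

/-! ### Assembly -/

/-- **Negative Triangle `≤₃` APSP through the distance product** (VW–W's route: Thm. 4.1, then the
tripartite graph of the proof of Thm. 5.1), assembled by transitivity (VW–W Prop. 1) with the proved
well-formedness of the three zoo families. [cite: VassilevskaWilliamsWilliams2018, Thm. 1.1 (proof p. 27:22)] -/
theorem negativeTriangle_fgReducible_APSP_of_minPlusProduct
    (htrans : fgReducible_pow_trans_of_sizeFitsWord)
    (h₁ : negativeTriangle_fgReducible_minPlusProduct) (h₂ : minPlusProduct_fgReducible_APSP) :
    negativeTriangle_fgReducible_APSP := by
  intro c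
  obtain ⟨c', h₁'⟩ := h₁ c
  obtain ⟨c'', h₂'⟩ := h₂ c'
  exact ⟨c'', htrans h₁' h₂' (NegativeTriangle_isStandard c) (MinPlusProduct_isStandard c')
    (APSP_isStandard c'') (NegativeTriangle_sizeFitsWord c)⟩

/-- **APSP `≤₃` Negative Triangle through the distance product** (VW–W's route: APSP `≤₃` distance
product, §2 p. 27:8, then Thm. 4.2), assembled by transitivity (VW–W Prop. 1) with the proved
well-formedness of the three zoo families. [cite: VassilevskaWilliamsWilliams2018, Thm. 1.1 (proof p. 27:22)] -/
theorem APSP_fgReducible_negativeTriangle_of_minPlusProduct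
    (htrans : fgReducible_pow_trans_of_sizeFitsWord)
    (h₁ : APSP_fgReducible_minPlusProduct) (h₂ : minPlusProduct_fgReducible_negativeTriangle) :
    APSP_fgReducible_negativeTriangle := by
  intro c
  obtain ⟨c', h₁'⟩ := h₁ c
  obtain ⟨c'', h₂'⟩ := h₂ c'
  exact ⟨c'', htrans h₁' h₂' (APSP_isStandard c) (MinPlusProduct_isStandard c')
    (NegativeTriangle_isStandard c'') (APSP_sizeFitsWord c)⟩

/-- **VW–W Thm. 1.1, (1) ⟺ (3), from the paper's four steps and transitivity.**
[cite: VassilevskaWilliamsWilliams2018, Thm. 1.1 (proof p. 27:22)] -/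
theorem subcubicEquivalent_APSP_negativeTriangle_of_minPlusProduct
    (htrans : fgReducible_pow_trans_of_sizeFitsWord)
    (h₁ : APSP_fgReducible_minPlusProduct) (h₂ : minPlusProduct_fgReducible_negativeTriangle)
    (h₃ : negativeTriangle_fgReducible_minPlusProduct) (h₄ : minPlusProduct_fgReducible_APSP) :
    subcubicEquivalent_APSP_negativeTriangle :=
  subcubicEquivalent_APSP_negativeTriangle_of_reductions
    (APSP_fgReducible_negativeTriangle_of_minPlusProduct htrans h₁ h₂)
    (negativeTriangle_fgReducible_APSP_of_minPlusProduct htrans h₃ h₄)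

/-- **VW–W Thm. 1.1, (1) ⟺ (5)** (`subcubicEquivalent_APSP_minPlusProduct` of `Conjectures`) is the
conjunction of the two classical reductions between APSP and the distance product.
[cite: VassilevskaWilliamsWilliams2018, Thm. 1.1 and §2 p. 27:8] -/
theorem subcubicEquivalent_APSP_minPlusProduct_of_reductions (h₁ : APSP_fgReducible_minPlusProduct)
    (h₂ : minPlusProduct_fgReducible_APSP) : subcubicEquivalent_APSP_minPlusProduct :=
  ⟨h₁, h₂⟩

/-- **The printed consequence, unconditional in well-formedness.** From the corrected transfer
property (VVW ICM 2018, Def. 2.1 and the remark following it) and VW–W's subcubic equivalence, APSP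
with polynomially bounded weights is truly subcubic for every weight exponent iff Negative Triangle
is ("either all of them have truly subcubic algorithms, or none of them do", Thm. 1.1): the
`IsStandard` hypotheses of `trulySubTime_APSP_iff_negativeTriangle_of_isStandard` are now theorems.
[cite: VassilevskaWilliamsWilliams2018, Thm. 1.1] -/
theorem trulySubTime_APSP_iff_negativeTriangle_of_facts
    (hfact : trulySubTime_of_fgReducible_of_sizeFitsWord)
    (hVW : subcubicEquivalent_APSP_negativeTriangle) : trulySubTime_APSP_iff_negativeTriangle :=
  trulySubTime_APSP_iff_negativeTriangle_of_isStandard_of_sizeFitsWord hfact hVW APSP_isStandard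
    NegativeTriangle_isStandard

end Literature.Computability.FineGrained
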